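import Mathlib.Data.ZMod.Basic
import Mathlib.Data.Finset.Powerset
import Mathlib.Data.Finset.Card
import Mathlib.Data.Fintype.Prod
import Mathlib.Data.Fintype.Powerset
import Mathlib.Tactic.DeriveFintype
import HarnessLib

/-!
# Pohlmann sets of a product `S₁ × S₁′ × S₂` of three CM abelian surfaces inside one dihedral octic CM field — a kernel census

COR-CM (cell `pub-hodgecm2`), literature seat André-3 (portfolio pass, 2026-08-20).  A finite, kernel-decided
computation (no named fact, no geometry, no `sorry`): the first rank-four face of `W_RK4`
(`CorCM/Geometry/Statements.lean`) whose Weil line is NOT reducible to a known case (Markman 2025 for Weil-type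
fourfolds; Shioda–Aoki for Fermat-type products; Moonen–Zarhin in dimension `≤ 5`) lives, after the orbit-collapse
reduction of `HOME/pub-hodgecm2-lit-andre-3/PORTFOLIO-lit-andre-3-g2.md` §2, on a product of THREE pairwise
non-isogenous simple CM abelian surfaces attached to one Galois CM field `F` with `Gal(F/ℚ) ≅ D₄`.  This file counts
its Hodge classes by Pohlmann's criterion.

MODEL (all of it is the statement of the theorems below; the DICTIONARY to geometry is cited, not formalised).
`G = D₄ = ⟨r, s ∣ r⁴ = s² = 1, s r s = r⁻¹⟩`, every element uniquely `rʲ sᶠ` (`j ∈ ℤ/4`, `f ∈ Bool`); `F` a CM field,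
Galois over `ℚ` with group `G` and complex conjugation `c = r²` (the centre).  The quartic CM subfields
`K₁ = F^{⟨s⟩}` and `K₂ = F^{⟨r³s⟩}` are NOT conjugate (`⟨s⟩ ~ ⟨r²s⟩`, `⟨rs⟩ ~ ⟨r³s⟩`); they are non-Galois quartic
CM fields with normal closure `F` and without imaginary quadratic subfield.  Embeddings:
`Hom(K₁, ℚ̄) = G/⟨s⟩ = {rⁱ⟨s⟩} ≅ ℤ/4` with `r · i = i + 1`, `s · i = -i`; `Hom(K₂, ℚ̄) = G/⟨r³s⟩ = {rⁱ⟨r³s⟩} ≅ ℤ/4`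
with `r · i = i + 1`, `s · i = 1 - i`; on both, `c = r²` is `i ↦ i + 2`.  CM types (one of each pair `{i, i+2}`):
`S₁` of type `(K₁, {0,1})`, `S₁′` of type `(K₁, {1,2})`, `S₂` of type `(K₂, {0,3})`.  `S₁ ≁ S₁′` (the types are not
related by `Aut(K₁) = {1, c}`: `c·{0,1} = {2,3}`; `S₁′` is the Galois conjugate `r(S₁)`), and `S₂` has a different CM
field, so the three simple CM surfaces are pairwise non-isogenous [cite: MoonenZarhin1999, section "Hodge groups of
simple abelian surfaces of CM-type", first paragraph ("in case (2) there are two such isogeny classes")].  These three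
types are exactly the cores of the corners of a rank-four face `(Φ; π, π′)` of `F` with `Φ = {1, s, rs, r}` (corner
types `Φ, Φ̄^{(π)}, Φ̄^{(π′)}, Φ^{(ππ′)}` induced from `(K₁,{0,1})`, `(K₂,{0,3})`, a twist of `(K₂,{0,3})`, and
`(K₁,{1,2})`; seat script `scratch/d4_blocks.py`, re-derivable by hand); by the census of the portfolio note EVERY
face of a `D₄` field has such a core (three or four pairwise non-isogenous CM surfaces).

DICTIONARY (cited): for the CM abelian variety `A = S₁ × S₁′ × S₂` with CM by `E = K₁ × K₁ × K₂` and type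
`Φ_A = {0,1} ⊔ {1,2} ⊔ {0,3}` on the twelve points `Hom(E, ℚ̄)`, the space `B^p(A)` of Hodge classes in `H^{2p}(A, ℚ)`
has dimension the number of `2p`-subsets `P ⊂ Hom(E, ℚ̄)` with `|gP ∩ Φ_A| = |gP ∩ Φ̄_A|` for all `g ∈ Gal(ℚ̄/ℚ)`
(acting through `G`) [cite: Pohlmann1968, Thm 1] = the tree's `Literature.AlgebraicGeometry.GaoUllmo2025.theorem31`
[cite: GaoUllmo2025, Thm 3.1]; products of divisor classes span the classes indexed by unions of two `c`-stable pairs.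

RESULTS (kernel): `B¹(A) = 6` (the six conjugate pairs), `B²(A) = 19 = 15 + 4`: FOUR exceptional codimension-2
Hodge classes, one Galois orbit, each of Künneth multidegree `(1,2,1)` on `S₁ × S₁′ × S₂` — so they meet all three
factors, and every PAIR of factors carries none (consistent with [cite: MoonenZarhin1999, same section, Proposition
"`X₁ ≁ X₂` ⟹ `Hg(X) = Hg(X₁) × Hg(X₂)`"] for two non-isogenous simple CM surfaces with the same quartic field).  Consequence
recorded in the portfolio note (not a Lean statement): the Hodge group of `S₁ × S₁′ × S₂` is a proper subtorus of
`Hg(S₁) × Hg(S₁′) × Hg(S₂)` although all three pair-projections are onto, so the Goursat-type reduction "pairwise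
independent ⇒ independent" used for products of `≥ 3` abelian surfaces in [cite: RamonMari2008, Prop. 2.18 (proof)]
does not apply to these (commutative) Hodge groups; the algebraicity of the four classes is not covered by
[MoonenZarhin1999] (dimension `6 > 5`) nor by Markman 2025 (no imaginary quadratic field acts).

## References
* [Pohlmann1968] H. Pohlmann, Algebraic cycles on abelian varieties of complex multiplication type, Ann. of Math. 88 (1968) 161–180, Thm 1.
* [GaoUllmo2025] Z. Gao, E. Ullmo, J. Inst. Math. Jussieu 25 (2025) = arXiv:2411.12249, Thm 3.1.
* [MoonenZarhin1999] B. Moonen, Yu. Zarhin, Hodge classes on abelian varieties of low dimension, Math. Ann. 315 (1999) 711–733 = arXiv:math/9901113 (held: `paper:arxiv-math_9901113`, chunk p0008), section "Hodge groups of simple abelian surfaces of CM-type".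
* [RamonMari2008] J. J. Ramón Marí, On the Hodge conjecture for products of certain surfaces, Collect. Math. 59 (2008) 1–26 = arXiv:math/0505357, Prop. 2.18.

## Provenance
Kernel cost: `decide +kernel` over the `495` four-subsets and the `66` two-subsets of twelve points, eight group
elements each.  Companion scripts (exact python): seat folder `scratch/face_census.py`, `pohlmann_core.py`,
`pohlmann_products.py`, `mt_rank.py` (dim MT = 5); copies in `run/shared/lean/pub/pub-hodgecm2/pub-hodgecm2-lit-andre-3/`.
-/

namespace Summit.HodgeConjecture.CorCM.Census.DihedralSurfaceTriple

open Finset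

/-- The twelve points `Hom(K₁,ℚ̄) ⊔ Hom(K₁,ℚ̄) ⊔ Hom(K₂,ℚ̄)`: (factor, embedding index). [cite: GaoUllmo2025, §2.1] -/
abbrev Pt : Type := Fin 3 × ZMod 4

/-- The element `rʲ sᶠ` of `D₄` acting on the embeddings of the factor `b`: `s` is `i ↦ -i` on the two `K₁`-factors
(factors `0` and `2`) and `i ↦ 1 - i` on the `K₂`-factor (factor `1`); `r` is `i ↦ i + 1`.
[cite: MoonenZarhin1999, section "Hodge groups of simple abelian surfaces of CM-type"] -/
def act (j : ZMod 4) (f : Bool) : Pt → Pt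
  | (b, i) =>
    let i' : ZMod 4 := if f then (if b = 1 then 1 - i else -i) else i
    (b, i' + j)

/-- The CM type of `A = S₁ × S₁′ × S₂`: `{0,1}` on factor `0` (`S₁`), `{0,3}` on factor `1` (`S₂`), `{1,2}` on
factor `2` (`S₁′`). [folklore] -/
def phi : Finset Pt := {((0 : Fin 3), (0 : ZMod 4)), (0, 1), (1, 0), (1, 3), (2, 1), (2, 2)}

/-- All twelve points. [folklore] -/
def pts : Finset Pt := univ

/-- Sanity: each factor's type is a CM type — it contains exactly one of `i`, `i + 2 = c·i` — and complex
conjugation `c = r²` acts as `i ↦ i + 2` (`act 2 false`). [folklore] -/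
theorem isCMType_phi : ∀ x : Pt, (x ∈ phi ↔ act 2 false x ∉ phi) := by decide

/-- Sanity: the eight maps `act j f` are the eight DISTINCT permutations of a faithful `D₄`-action on each factor
(`r` of order `4`, `s` an involution, `s r s = r⁻¹`), checked pointwise. [folklore] -/
theorem act_relations : (∀ x : Pt, act 0 true (act 0 true x) = x) ∧ (∀ x : Pt, act 1 false (act 3 false x) = x) ∧
    (∀ x : Pt, act 0 true (act 1 false (act 0 true x)) = act 3 false x) ∧
    (∀ j j' : ZMod 4, ∀ f f' : Bool, (∀ x : Pt, act j f x = act j' f' x) → j = j' ∧ f = f') := by decide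

/-- Pohlmann's condition with multiplicity `k`, as a Boolean test: `#{x ∈ P | g·x ∈ Φ} = k` for all
`g = rʲ sᶠ ∈ D₄` (`k = 2` for `4`-sets, `k = 1` for `2`-sets). [cite: GaoUllmo2025, Thm 3.1 eq. (3.2)] -/
def eq32 (k : ℕ) (P : Finset Pt) : Bool :=
  decide (∀ g : ZMod 4 × Bool, (P.filter fun x => act g.1 g.2 x ∈ phi).card = k)

/-- The Pohlmann `4`-sets (a basis of `B²(A) ⊗ ℚ̄` by [cite: GaoUllmo2025, Thm 3.1]). -/
def hodgeSets : Finset (Finset Pt) := (pts.powersetCard 4).filter fun P => eq32 2 P = true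

/-- The Pohlmann `2`-sets (a basis of `B¹(A) ⊗ ℚ̄` by [cite: GaoUllmo2025, Thm 3.1], `p = 1`). -/
def divisorSets : Finset (Finset Pt) := (pts.powersetCard 2).filter fun P => eq32 1 P = true

/-- The six complex-conjugate pairs `{x, c·x}`. [folklore] -/
def conjPairs : Finset (Finset Pt) := pts.image fun x => {x, act 2 false x}

/-- The exceptional Pohlmann `4`-sets: those not stable under `c` (not a union of two conjugate pairs, hence not
in the span of products of divisor classes). [cite: MoonenZarhin1999, Introduction] -/
def exceptional : Finset (Finset Pt) := hodgeSets.filter fun P => ∃ x ∈ P, act 2 false x ∉ P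

set_option maxRecDepth 8000 in
set_option maxHeartbeats 4000000 in
/-- **Degree one**: the Pohlmann `2`-sets are exactly the six conjugate pairs; via [cite: GaoUllmo2025, Thm 3.1]
`dim_ℚ B¹(S₁ × S₁′ × S₂) = 6 = ρ(S₁) + ρ(S₁′) + ρ(S₂)` (no divisor classes of mixed Künneth type: the factors are
pairwise non-isogenous), and the products of divisor classes span the `15` unions of two distinct pairs. -/
theorem divisorSets_eq : divisorSets = conjPairs ∧ conjPairs.card = 6 := by decide +kernel

set_option maxRecDepth 8000 in
set_option maxHeartbeats 4000000 in
/-- **The census**: `19` Pohlmann `4`-sets; via [cite: GaoUllmo2025, Thm 3.1] `dim_ℚ B²(S₁ × S₁′ × S₂) = 19 > 15`. -/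
theorem card_hodgeSets : hodgeSets.card = 19 := by decide +kernel

set_option maxRecDepth 8000 in
set_option maxHeartbeats 4000000 in
/-- **The four exceptional classes**, explicitly: `{(0,i), (1,i), (1,i+1), (2,i)}` for `i ∈ ℤ/4` — one `D₄`-orbit,
each of Künneth multidegree `(1,2,1)` (one embedding of `S₁`, two of `S₂`, one of `S₁′`), so every exceptional class
meets all three factors and no pair `Sᵢ × Sⱼ` carries one. For `i = 0`: `e₀(S₁) ⊗ (e₀ ∧ e₁)(S₂) ⊗ e₀(S₁′)`, of Hodge type
`(1,0)+(1,1)+(0,1) = (2,2)`. [cite: GaoUllmo2025, Thm 3.1] -/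
theorem exceptional_eq : exceptional =
    { {((0 : Fin 3), (0 : ZMod 4)), (1, 0), (1, 1), (2, 0)},
      {((0 : Fin 3), (1 : ZMod 4)), (1, 1), (1, 2), (2, 1)},
      {((0 : Fin 3), (2 : ZMod 4)), (1, 2), (1, 3), (2, 2)},
      {((0 : Fin 3), (3 : ZMod 4)), (1, 3), (1, 0), (2, 3)} } := by
  decide +kernel

set_option maxRecDepth 8000 in
set_option maxHeartbeats 4000000 in
/-- The non-exceptional Pohlmann `4`-sets are exactly the `15` unions of two distinct conjugate pairs
(`19 = 15 + 4`). [cite: GaoUllmo2025, Thm 3.1] -/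
theorem card_nonexceptional : (hodgeSets.filter fun P => ∀ x ∈ P, act 2 false x ∈ P).card = 15 ∧
    (∀ P ∈ hodgeSets, (∀ x ∈ P, act 2 false x ∈ P) →
      ∃ Q₁ ∈ conjPairs, ∃ Q₂ ∈ conjPairs, Q₁ ≠ Q₂ ∧ P = Q₁ ∪ Q₂) := by
  decide +kernel

end Summit.HodgeConjecture.CorCM.Census.DihedralSurfaceTriple
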